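import Mathlib
import HarnessLib
import Literature.AlgebraicGeometry.Resolution.MarkedIdealsEtale
import Literature.AlgebraicGeometry.Resolution.BlowupsScaling
import Literature.AlgebraicGeometry.Resolution.AffineBlowupUnique
import Literature.AlgebraicGeometry.Resolution.KollarFunctorLinearCentre

/-!
# COLON GLUE: colon ideal sheaves along open immersions, powers / colons / radicals of affine
# ideal sheaves
(crux stmt-ResolutionOfSingularities-15640 `WildQuotients.WildQuotientResolution`, line `Sketch`;
chain w45c RUNG V5, res-L1-w45c-plan-1 ORDER 12:49:51Z «COLON GLUE» for the β‴/β″ variant of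
`HP₀` (`L/w45c/HP0-ONESHOT-DESIGN.md` add6736b429806c9 §2/§4); written by res-D-pv-033 AS
res-L1-w45c-stub-5. [OURS · L1 W4.5c] — generic ideal-sheaf bookkeeping over the tree's
`Literature.AlgebraicGeometry.Resolution.colon` (MarkedIdeals), `comap_colon_of_flat`
(MarkedIdealsEtale, Matsumura 7.4), `colon_top`, `affineBlowup.idealSheaf_mul` (BlowupsScaling),
`affineBlowup.support_idealSheaf` (AffineBlowupUnique); NOT a statement of any manuscript.)

* (L2) `comap_colon_of_isOpenImmersion` — `(L : M)|_U = (L|_U : M|_U)` along an open immersion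
  into a locally Noetherian scheme (open immersions are flat);
* (L3′) `comap_colon_eq_of_comap_eq_top` — if `M|_U = ⊤` then `(L : M)|_U = L|_U` (with the
  tree's `colon_top`);
* (L4) `affineBlowup.idealSheaf_pow`, `Ideal.map_colon_of_bijective`, `affineBlowup.idealSheaf_colon`
  — `(Iⁿ)~ = (I~)ⁿ`, `(I : J)~ = (I~ : J~)` on `Spec R` (`R` Noetherian for the colon);
* (L5) `affineBlowup.idealSheaf_radical`, `affineBlowup.vanishingIdeal_zeroLocus` —
  `(√I)~ = √(I~)` and `vanishingIdeal V(I) = (√I)~` on `Spec R`.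
-/

-- single-problem summit: the doubled namespace component `ResolutionOfSingularities` is forced
set_option linter.dupNamespace false

noncomputable section

open CategoryTheory AlgebraicGeometry TopologicalSpace
open AlgebraicGeometry.Scheme.IdealSheafData
open Literature.AlgebraicGeometry.Resolution

namespace Summit.ResolutionOfSingularities.ResolutionOfSingularities.Theorems.WildQuotientResolution.BlowupExit

universe u

/-! ## (L2)/(L3′) colon ideal sheaves restrict along open immersions -/

/-- **(L2) `(L : M)|_U = (L|_U : M|_U)`**: the colon ideal sheaf commutes with pull-back along an
open immersion `f : X ⟶ Y` into a locally Noetherian scheme (`f` is flat; tree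
`comap_colon_of_flat`, Matsumura Thm. 7.4 (iii)). [folklore] -/
theorem comap_colon_of_isOpenImmersion {X Y : Scheme.{u}} (f : X ⟶ Y) [IsOpenImmersion f]
    [IsLocallyNoetherian Y] (L M : Y.IdealSheafData) :
    (colon L M).comap f = colon (L.comap f) (M.comap f) := by
  haveI : IsLocallyNoetherian X := isLocallyNoetherian_of_isOpenImmersion f
  exact comap_colon_of_flat f L M

/-- **(L3′)** If `M|_U = ⊤` (e.g. `U` misses the support of `M`) then `(L : M)|_U = L|_U`.
[folklore] -/
theorem comap_colon_eq_of_comap_eq_top {X Y : Scheme.{u}} (f : X ⟶ Y) [IsOpenImmersion f]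
    [IsLocallyNoetherian Y] (L M : Y.IdealSheafData) (h : M.comap f = ⊤) :
    (colon L M).comap f = L.comap f := by
  rw [comap_colon_of_isOpenImmersion, h, colon_top]

/-! ## (L4) powers and colons of affine ideal sheaves -/

variable {R : Type u} [CommRing R]

/-- **(L4a) `(Iⁿ)~ = (I~)ⁿ`** on `Spec R`. [folklore] -/
theorem affineBlowup.idealSheaf_pow (I : Ideal R) (n : ℕ) :
    affineBlowup.idealSheaf (I ^ n) = affineBlowup.idealSheaf I ^ n := by
  induction n with
  | zero => rw [pow_zero, pow_zero, Ideal.one_eq_top, affineBlowup.idealSheaf_top,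
      Scheme.IdealSheafData.one_eq_top]
  | succ n ih => rw [pow_succ, pow_succ, affineBlowup.idealSheaf_mul, ih]

/-- **Colon ideals along a ring isomorphism**: `f (I : J) = (f I : f J)` for a bijective ring map.
[folklore] -/
theorem Ideal.map_colon_of_bijective {A B : Type*} [CommRing A] [CommRing B] (f : A →+* B)
    (hf : Function.Bijective f) (I J : Ideal A) :
    (I.colon (J : Set A)).map f = (I.map f).colon (J.map f : Set B) := by
  let e : A ≃+* B := RingEquiv.ofBijective f hf
  have hmap : ∀ K : Ideal A, K.map f = K.comap (e.symm : B →+* A) := fun K =>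
    Ideal.map_comap_of_equiv (I := K) e
  rw [hmap, hmap, hmap]
  ext x
  simp only [Ideal.mem_comap, Submodule.mem_colon, SetLike.mem_coe, smul_eq_mul]
  constructor
  · intro h y hy
    rw [map_mul]
    exact h _ hy
  · intro h p hp
    obtain ⟨y, rfl⟩ := e.symm.surjective p
    have := h y hp
    rwa [map_mul] at this

/-- **(L4b) `(I : J)~ = (I~ : J~)`** on `Spec R`, `R` Noetherian (sections of the colon sheaf on the
affine `⊤` are the colon of the sections, tree `ideal_colon`). [folklore] -/
theorem affineBlowup.idealSheaf_colon [IsNoetherianRing R] (I J : Ideal R) :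
    affineBlowup.idealSheaf (I.colon (J : Set R)) =
      colon (affineBlowup.idealSheaf I) (affineBlowup.idealSheaf J) := by
  apply Scheme.IdealSheafData.ext_of_isAffine
  rw [ideal_colon]
  simp only [affineBlowup.idealSheaf, ideal_ofIdealTop_top]
  exact Ideal.map_colon_of_bijective _
    (Scheme.ΓSpecIso (.of R)).symm.commRingCatIsoToRingEquiv.bijective I J

/-! ## (L5) radicals and vanishing ideals of affine ideal sheaves -/

/-- **(L5a) `(√I)~ = √(I~)`** on `Spec R`. [folklore] -/
theorem affineBlowup.idealSheaf_radical (I : Ideal R) :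
    affineBlowup.idealSheaf I.radical = (affineBlowup.idealSheaf I).radical := by
  apply Scheme.IdealSheafData.ext_of_isAffine
  simp only [Scheme.IdealSheafData.radical_ideal, affineBlowup.idealSheaf, ideal_ofIdealTop_top]
  exact Ideal.map_radical_of_surjective
    (Scheme.ΓSpecIso (.of R)).symm.commRingCatIsoToRingEquiv.surjective
    (by
      intro x hx
      rw [RingHom.mem_ker] at hx
      have hinj : Function.Injective (Scheme.ΓSpecIso (.of R)).symm.commRingCatIsoToRingEquiv :=
        (Scheme.ΓSpecIso (.of R)).symm.commRingCatIsoToRingEquiv.injective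
      have hx0 : x = 0 := hinj (by
        change (Scheme.ΓSpecIso (.of R)).symm.hom.hom x = (Scheme.ΓSpecIso (.of R)).symm.hom.hom 0
        rw [hx, map_zero])
      rw [hx0]
      exact I.zero_mem)

/-- **(L5b) `vanishingIdeal V(I) = (√I)~`** on `Spec R`: the vanishing ideal sheaf of the closed
set `V(I)` is the affine ideal sheaf of the radical (Mathlib `vanishingIdeal_support` + the
support `V(I)` of `I~`, tree `affineBlowup.support_idealSheaf`). [folklore] -/
theorem affineBlowup.vanishingIdeal_zeroLocus (I : Ideal R) :
    vanishingIdeal ⟨PrimeSpectrum.zeroLocus (I : Set R), PrimeSpectrum.isClosed_zeroLocus _⟩ =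
      affineBlowup.idealSheaf I.radical := by
  rw [affineBlowup.idealSheaf_radical, ← vanishingIdeal_support]
  congr 1
  ext1
  exact (affineBlowup.support_idealSheaf I).symm

end Summit.ResolutionOfSingularities.ResolutionOfSingularities.Theorems.WildQuotientResolution.BlowupExit

end
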